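import Literature.Computability.Cryptography.TreeSigPrograms
import Literature.Computability.Cryptography.SignaturesManyAnswers
import HarnessLib

/-!
# The authentication-tree scheme, III: the chosen-message attack as a finite average, against a node interface

Topic `Literature/Computability/Cryptography`; continues `TreeSigSpec.lean` (Construction 6.4.16 `TreeSig.scheme P`)
and `TreeSigPrograms.lean` (the chain against a node interface, `chainG`). The security proof of Goldreich's
Prop. 6.4.15 / 6.4.17 analyses a chosen-message attack on the tree scheme query by query, replacing the source of
the node keys (the pseudorandom function, then a random function, then the reduction's own coins with one planted
key). This file sets up the DETERMINISTIC core of the attack once, against an arbitrary source: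

* `TreeSig.sigGI pkN sgN α σ` — the signature at the leaf `σ` against the node interface `(pkN, sgN)`;
  `TreeSig.sigG P n Tab` — the instance whose nodes are read off a block assignment `Tab : label ↦ block`
  (`sigOf_eq_sigG`: the real signer is `Tab = blk n k`);
* `TreeSig.pkT`, `xA`, `ℓx`, `TA`, `cA` — the verification key on the seed `k`, the forger's input, its length (a
  function of `n` alone, thanks to the padding of the root key) and the forger's round and coin budgets;
* `TreeSig.ForgeWith P 𝒜 n pk O r` — the forgery event of the deterministic indexed attack of `𝒜` with coins `r`
  against root key `pk` and an arbitrary indexed answering rule `O i α` (the `i`-th signature);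
* **`SignatureScheme.cmaExp_toReal_eq_uniformAvg_idx_of_keys`** — the many-query factorisation of
  `SignaturesManyAnswers.lean` with the coin-reading hypothesis required only of the keys `G(1ⁿ)` actually generates
  (the tree signer reads `n = |1ⁿ|` coins, a bound meaningful for well-formed keys only);
* **`TreeSig.forgeProb_eq_uniformAvg`** — for a well-formed `P`,
  `forgeProb (scheme P) 𝒜 n = 𝔼_{k ← U_κ} 𝔼_{r ← U_{cA}} 𝔼_{ρ ← U_{TA·n}} 1{ForgeWith … (pk_ε(k)) (i, α ↦ sigG (blk n k) α (blk n i ρ)) r}`: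
  the real attack is the node-interface attack with the `i`-th leaf the `i`-th block of `ρ`.

All statements proved; no named facts.

## References

* O. Goldreich, *Foundations of Cryptography II: Basic Applications*, CUP 2004, §6.1.3 (the probabilistic signing
  oracle), §6.4.2.2–6.4.2.3 (proofs of Prop. 6.4.15 and Prop. 6.4.17, analysed query by query).
-/

namespace Literature.Computability.Cryptography

open Filter Asymptotics _root_.Computability Complexity Complexity.Brick Finset Polynomial

/-! ### The many-query factorisation, coin reading required of generated keys only -/

namespace SignatureScheme

/-- **The chosen-message experiment with many queries as a triple finite average** — as
`cmaExp_toReal_eq_uniformAvg_idx`, but the hypothesis that the signer reads at most the first `C` of its coins is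
required only under the signing keys `G(1ⁿ)` generates (coins of the prescribed length). [Goldreich 2004, Def. 6.1.2
with §6.1.3] [folklore] -/
theorem cmaExp_toReal_eq_uniformAvg_idx_of_keys (S : SignatureScheme) (𝒜 : OracleAdversary (List Bool × List Bool))
    (n : ℕ) (E : Set (List Bool × List (List Bool) × Option (List Bool × List Bool))) [DecidablePred (· ∈ E)]
    (C : ℕ) (hread : ∀ r₀ : List Bool, r₀.length = S.keyGen.coinLen (unaryEncodeNat n).length → ∀ q ρ : List Bool,
      ρ.length = S.sign.coinLen (pairCode ((S.keyGen.run n r₀).2, q)).length →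
      S.sign.run ((S.keyGen.run n r₀).2, q) ρ = S.sign.run ((S.keyGen.run n r₀).2, q) (ρ.take C)) :
    ((S.cmaExpPMF 𝒜 n).toOuterMeasure E).toReal =
      uniformAvg (S.keyGen.coinLen (unaryEncodeNat n).length) fun r₀ =>
        uniformAvg (𝒜.coins.eval (boolPair (unaryEncodeNat n) (S.keyGen.run n r₀).1).length) fun r =>
          uniformAvg (𝒜.fuel.eval (boolPair (unaryEncodeNat n) (S.keyGen.run n r₀).1).length * C) fun ρ =>
            if ((S.keyGen.run n r₀).1,
                𝒜.alg.queriesIdx (fun i => S.sigOracleWith (S.keyGen.run n r₀).2 (Yao.blk C i ρ))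
                  (𝒜.fuel.eval (boolPair (unaryEncodeNat n) (S.keyGen.run n r₀).1).length)
                  (boolPair (boolPair (unaryEncodeNat n) (S.keyGen.run n r₀).1) r),
                𝒜.alg.runIdx (fun i => S.sigOracleWith (S.keyGen.run n r₀).2 (Yao.blk C i ρ))
                  (𝒜.fuel.eval (boolPair (unaryEncodeNat n) (S.keyGen.run n r₀).1).length)
                  (boolPair (boolPair (unaryEncodeNat n) (S.keyGen.run n r₀).1) r)) ∈ E then 1 else 0 := by
  classical
  set L := S.keyGen.coinLen (unaryEncodeNat n).length with hL
  set Cn : List Bool → ℕ := fun pk => 𝒜.coins.eval (boolPair (unaryEncodeNat n) pk).length with hCn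
  set T : List Bool → ℕ := fun pk => 𝒜.fuel.eval (boolPair (unaryEncodeNat n) pk).length with hT
  -- Step A: for generated keys and fixed machine input, the mass of the `E`-section is the `ρ`-average
  have hA : ∀ (r₀ : List Bool), r₀.length = L → ∀ (xr : List Bool),
      ((𝒜.alg.probTranscript (fun m => S.sigPMF (S.keyGen.run n r₀).2 m) (T (S.keyGen.run n r₀).1) xr).toOuterMeasure
        {t | ((S.keyGen.run n r₀).1, t) ∈ E}).toReal =
        uniformAvg (T (S.keyGen.run n r₀).1 * C) fun ρ =>
          if ((S.keyGen.run n r₀).1, 𝒜.alg.queriesIdx (fun i => S.sigOracleWith (S.keyGen.run n r₀).2 (Yao.blk C i ρ)) (T (S.keyGen.run n r₀).1) xr,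
            𝒜.alg.runIdx (fun i => S.sigOracleWith (S.keyGen.run n r₀).2 (Yao.blk C i ρ)) (T (S.keyGen.run n r₀).1) xr) ∈ E then 1 else 0 := by
    intro r₀ hr₀ xr
    set ks := S.keyGen.run n r₀
    letI : DecidablePred (· ∈ {t : List (List Bool) × Option (List Bool × List Bool) | (ks.1, t) ∈ E}) :=
      fun t => inferInstanceAs (Decidable ((ks.1, t) ∈ E))
    rw [𝒜.alg.toReal_probTranscript_uniformSeed xr C (fun q ρ => S.sigOracleWith ks.2 ρ q) (fun m => S.sigPMF ks.2 m)
      (fun q => S.sigPMF_eq_map_uniform_sigOracleWith C ks.2 q (hread r₀ hr₀ q)) (T ks.1) {t | (ks.1, t) ∈ E}]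
    refine SigOWF.uniformAvg_congr' fun ρ _ => if_congr Iff.rfl rfl rfl
  -- Step B: average over the key-generation coins and the forger's coins
  set G : List Bool × List Bool → PMF (List Bool × List (List Bool) × Option (List Bool × List Bool)) :=
    fun ks => (𝒜.probTranscriptPMF (fun m => S.sigPMF ks.2 m) (boolPair (unaryEncodeNat n) ks.1)).map
      fun t => (ks.1, t) with hG
  have hexp : S.cmaExpPMF 𝒜 n = (PMF.uniformOfFintype (List.Vector Bool L)).bind (G ∘ fun v => S.keyGen.run n v.toList) := by
    rw [SignatureScheme.cmaExpPMF, SignatureScheme.keyPMF, RandAlg.outputPMF, PMF.bind_map]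
  have hGE : ∀ r₀ : List Bool, r₀.length = L → ((G (S.keyGen.run n r₀)).toOuterMeasure E).toReal =
      uniformAvg (Cn (S.keyGen.run n r₀).1) fun r => uniformAvg (T (S.keyGen.run n r₀).1 * C) fun ρ =>
        if ((S.keyGen.run n r₀).1, 𝒜.alg.queriesIdx (fun i => S.sigOracleWith (S.keyGen.run n r₀).2 (Yao.blk C i ρ)) (T (S.keyGen.run n r₀).1)
              (boolPair (boolPair (unaryEncodeNat n) (S.keyGen.run n r₀).1) r),
            𝒜.alg.runIdx (fun i => S.sigOracleWith (S.keyGen.run n r₀).2 (Yao.blk C i ρ)) (T (S.keyGen.run n r₀).1)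
              (boolPair (boolPair (unaryEncodeNat n) (S.keyGen.run n r₀).1) r)) ∈ E then 1 else 0 := by
    intro r₀ hr₀
    set ks := S.keyGen.run n r₀
    rw [hG]
    simp only
    rw [PMF.toOuterMeasure_map_apply, OracleAdversary.probTranscriptPMF, PMF.toOuterMeasure_bind_apply, tsum_fintype,
      ENNReal.toReal_sum (fun v _ => ?_), SigOWF.uniformAvg_eq_sum_div]
    · refine Finset.sum_congr rfl fun v _ => ?_
      rw [ENNReal.toReal_mul, PMF.uniformOfFintype_apply, card_vector, Fintype.card_bool, ENNReal.toReal_inv]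
      simp only [ENNReal.toReal_pow, ENNReal.toReal_ofNat, Nat.cast_pow, Nat.cast_ofNat]
      rw [show (fun t : List (List Bool) × Option (List Bool × List Bool) => (ks.1, t)) ⁻¹' E = {t | (ks.1, t) ∈ E} from rfl,
        hA r₀ hr₀, div_eq_inv_mul]
    · refine ENNReal.mul_ne_top ?_ ?_
      · rw [PMF.uniformOfFintype_apply]
        exact ENNReal.inv_ne_top.2 (by exact_mod_cast Fintype.card_ne_zero)
      · exact ne_top_of_le_ne_top ENNReal.one_ne_top (pmf_toOuterMeasure_apply_le_one _ _)
  rw [hexp, PMF.toOuterMeasure_bind_apply, tsum_fintype, ENNReal.toReal_sum (fun v _ => ?_), SigOWF.uniformAvg_eq_sum_div]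
  · refine Finset.sum_congr rfl fun v _ => ?_
    rw [ENNReal.toReal_mul, Function.comp_apply, hGE _ v.toList_length, PMF.uniformOfFintype_apply, card_vector, Fintype.card_bool,
      ENNReal.toReal_inv]
    simp only [ENNReal.toReal_pow, ENNReal.toReal_ofNat, Nat.cast_pow, Nat.cast_ofNat]
    rw [div_eq_inv_mul]
  · refine ENNReal.mul_ne_top ?_ ?_
    · rw [PMF.uniformOfFintype_apply]
      exact ENNReal.inv_ne_top.2 (by exact_mod_cast Fintype.card_ne_zero)
    · exact ne_top_of_le_ne_top ENNReal.one_ne_top (pmf_toOuterMeasure_apply_le_one _ _)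

end SignatureScheme

namespace TreeSig

variable (P : Spec)

/-! ### Signatures against a node interface -/

/-- The signature at the leaf `σ` of the document `α` against the node interface `(pkN, sgN)`: the coded list
`σ, chainG pkN sgN α ε σ`. [Goldreich 2004, Construction 6.4.14 / 6.4.16 (signing)] [cite: Goldreich2004, Construction 6.4.16] -/
def sigGI (pkN : List Bool → List Bool) (sgN : List Bool → List Bool → List Bool) (α σ : List Bool) : List Bool :=
  encList (σ :: chainG pkN sgN α [] σ)

/-- The leaf of a node-interface signature. [folklore] -/
@[simp] theorem fstF_sigGI (pkN : List Bool → List Bool) (sgN : List Bool → List Bool → List Bool) (α σ : List Bool) :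
    fstF (sigGI pkN sgN α σ) = σ := by
  rw [sigGI, encList_cons, fstF_boolPair]

/-- The signature at the leaf `σ` when the nodes are read off the block assignment `Tab` (label ↦ block).
[Goldreich 2004, Construction 6.4.16] [cite: Goldreich2004, Construction 6.4.16] -/
def sigG (n : ℕ) (Tab : List Bool → List Bool) (α σ : List Bool) : List Bool :=
  sigGI (fun L => pkOf P n (Tab L)) (fun L m => signOf P n (Tab L) m) α σ

/-- **The real signer is the block-table signer with `Tab = blk n k`.** [Goldreich 2004, Construction 6.4.16] [folklore] -/
theorem sigOf_eq_sigG (n : ℕ) (k α σ : List Bool) : sigOf P n k α σ = sigG P n (blk P n k) α σ := by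
  rw [sigOf, sigG, sigGI, pathLabels, chain_eq_chainG P n (blk P n k) α [] σ]

/-! ### The verification key, the forger's input and its budgets -/

/-- The verification key of the tree scheme on root key `pk`: `⟨1ⁿ, padded pk⟩`. [folklore] -/
def pkT (n : ℕ) (pk : List Bool) : List Bool := boolPair (ones n) (padPk P n pk)

/-- The root key on the seed `k`: `pk_ε(k)`. [folklore] -/
def rootPk (n : ℕ) (k : List Bool) : List Bool := pkOf P n (blk P n k [])

/-- `G'(1ⁿ; k).1 = pkT (rootPk k)`. [folklore] -/
theorem keyGenT_fst (n : ℕ) (k : List Bool) : ((keyGenT P).run n k).1 = pkT P n (rootPk P n k) := rfl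

/-- The forger's input on root key `pk`: `⟨1ⁿ, pk'⟩`. [folklore] -/
def xA (n : ℕ) (pk : List Bool) : List Bool := boolPair (unaryEncodeNat n) (pkT P n pk)

/-- The length of the forger's input, a function of `n` alone: `4n + 2 PK(n) + 6`. [folklore] -/
def ℓx (n : ℕ) : ℕ := 4 * n + 2 * P.PK.eval n + 6

/-- `|xA n pk| = ℓx n` for `|pk| ≤ PK(n)`. [folklore] -/
theorem length_xA {n : ℕ} {pk : List Bool} (h : pk.length ≤ P.PK.eval n) : (xA P n pk).length = ℓx P n := by
  simp only [xA, pkT, length_boolPair, length_padPk P h, Complexity.unaryEncodeNat_eq_replicate, List.length_replicate, ℓx]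
  omega

/-- The forger's round budget at level `n`. [folklore] -/
def TA (𝒜 : OracleAdversary (List Bool × List Bool)) (n : ℕ) : ℕ := 𝒜.fuel.eval (ℓx P n)

/-- The forger's coin budget at level `n`. [folklore] -/
def cA (𝒜 : OracleAdversary (List Bool × List Bool)) (n : ℕ) : ℕ := 𝒜.coins.eval (ℓx P n)

/-- **The forgery event of the deterministic indexed attack**: `𝒜` with coins `r` on `⟨1ⁿ, pk'⟩`, its `i`-th query
answered by `O i`, outputs a forgery (accepted by the tree verifier, on a document not queried).
[Goldreich 2004, Def. 6.1.2; proofs of Prop. 6.4.15 / 6.4.17] [cite: Goldreich2004, Def. 6.1.2] -/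
def ForgeWith (𝒜 : OracleAdversary (List Bool × List Bool)) (n : ℕ) (pk : List Bool) (O : ℕ → List Bool → List Bool)
    (r : List Bool) : Prop :=
  (pkT P n pk, 𝒜.alg.queriesIdx O (TA P 𝒜 n) (boolPair (xA P n pk) r), 𝒜.alg.runIdx O (TA P 𝒜 n) (boolPair (xA P n pk) r)) ∈
    (scheme P).forgeEvent

/-- `ForgeWith` unfolded: some output `(α, sig)` with `V'(pk', α, sig)` and `α` never queried. [folklore] -/
theorem forgeWith_iff (𝒜 : OracleAdversary (List Bool × List Bool)) (n : ℕ) (pk : List Bool) (O : ℕ → List Bool → List Bool)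
    (r : List Bool) :
    ForgeWith P 𝒜 n pk O r ↔ ∃ α sig, 𝒜.alg.runIdx O (TA P 𝒜 n) (boolPair (xA P n pk) r) = some (α, sig) ∧
      verifyT P (pkT P n pk) α sig = true ∧ α ∉ 𝒜.alg.queriesIdx O (TA P 𝒜 n) (boolPair (xA P n pk) r) :=
  Iff.rfl

/-! ### The real attack as a triple average -/

section Real

variable {P}

/-- The root key on a seed of the prescribed length is short. [folklore] -/
theorem length_rootPk_le (hW : P.WF) {n : ℕ} {k : List Bool} (hk : k.length = P.κ n) : (rootPk P n k).length ≤ P.PK.eval n := by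
  refine hW.hPK n _ ?_
  rw [List.length_take, wfBlock_blk hW hk (by simp : ([] : List Bool).length ≤ n)]
  exact min_eq_left (pG_le_R n)

/-- The indexed signing oracle of the experiment under the seed `k` with leaf blocks `ρ`: the `i`-th answer signs at
the leaf `blk n i ρ`. [Goldreich 2004, §6.1.3; Construction 6.4.16] [folklore] -/
theorem sigOracleWith_keyGenT (n : ℕ) (k ρ' α : List Bool) (hρ : ρ'.length ≤ n) :
    (scheme P).sigOracleWith ((keyGenT P).run n k).2 ρ' α = sigG P n (blk P n k) α ρ' := by
  rw [SignatureScheme.sigOracleWith, keyGenT_run_snd]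
  show (signT P).run (boolPair (ones n) k, α) _ = _
  rw [signT_run, List.take_take, sigOf_eq_sigG]
  congr 1
  apply List.take_of_length_le
  show ρ'.length ≤ min n (pairCode (boolPair (ones n) k, α)).length
  simp only [pairCode, Function.uncurry_apply_pair, length_boolPair, List.length_replicate]
  omega

variable (P)

/-- **The forging probability against the tree scheme as a triple average** over the seed `k`, the forger's coins
`r` and the leaves `ρ` (block `i` = leaf of the `i`-th answer) of the indicator of `ForgeWith` for the block-table
signer `Tab = blk n k`. [Goldreich 2004, Def. 6.1.2 with §6.1.3; Construction 6.4.16] [folklore] -/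
theorem forgeProb_eq_uniformAvg (hW : P.WF) (𝒜 : OracleAdversary (List Bool × List Bool)) (n : ℕ)
    [∀ k r ρ, Decidable (ForgeWith P 𝒜 n (rootPk P n k) (fun i α => sigG P n (blk P n k) α (Yao.blk n i ρ)) r)] :
    forgeProb (scheme P) 𝒜 n =
      uniformAvg (P.κ n) fun k => uniformAvg (cA P 𝒜 n) fun r => uniformAvg (TA P 𝒜 n * n) fun ρ =>
        if ForgeWith P 𝒜 n (rootPk P n k) (fun i α => sigG P n (blk P n k) α (Yao.blk n i ρ)) r then 1 else 0 := by
  classical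
  have hκ : (scheme P).keyGen.coinLen (unaryEncodeNat n).length = P.κ n := by
    show (keyGenT P).coinLen _ = _
    rw [Complexity.unaryEncodeNat_eq_replicate, List.length_replicate]; rfl
  rw [forgeProb, (scheme P).cmaExp_toReal_eq_uniformAvg_idx_of_keys 𝒜 n (scheme P).forgeEvent n (fun r₀ _ q ρ _ => ?_), hκ]
  · refine SigOWF.uniformAvg_congr' fun k hk => ?_
    have hpk : ((scheme P).keyGen.run n k).1 = pkT P n (rootPk P n k) := keyGenT_fst P n k
    have hlen : (boolPair (unaryEncodeNat n) (pkT P n (rootPk P n k))).length = ℓx P n := length_xA P (length_rootPk_le hW hk)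
    simp only [hpk, hlen]
    refine SigOWF.uniformAvg_congr' fun r _ => SigOWF.uniformAvg_congr' fun ρ _ => ?_
    have hO : (fun i => (scheme P).sigOracleWith ((scheme P).keyGen.run n k).2 (Yao.blk n i ρ)) =
        fun i α => sigG P n (blk P n k) α (Yao.blk n i ρ) := by
      funext i α
      exact sigOracleWith_keyGenT n k _ α (Yao.length_blk_le n i ρ)
    rw [hO]
    exact if_congr Iff.rfl rfl rfl
  · show (signT P).run (boolPair (ones n) r₀, q) ρ = (signT P).run (boolPair (ones n) r₀, q) (ρ.take n)
    exact signT_run_take P n r₀ q ρ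

end Real

end TreeSig

end Literature.Computability.Cryptography
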